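import Summits.QuantumFields.YangMills.Theorems.CurvaturePoincareBoxLineSums
import HarnessLib

/-!
# LINE 30 «CurvaturePoincare» — THE BOX UHLENBECK LEMMA (planNP's `stub_boxUhlenbeck`, `C = 3`): distance to pure gauge in `ℓ²(box bonds)` is at most
# `3n·‖curvature‖_{ℓ²(box plaquettes)}`, by AVERAGED AXIAL GAUGES

Crux of record `PoincareLipschitz.MesoscopicConcentrationL` (stmt-QuantumFields-23532; LINE 30 skeleton `Cruxes/HistoryTailL/Lines/curvature_poincare.lean`
sha16 e95b7bfb5ac8bc91; NP sub-plan `Cruxes/HistoryTailL/Lines/curvature_poincare_planNP.lean`, ideator ym-r3-idea-2 g16); cell `ym3-torus` (YM ladder rung R3 =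
continuum `SU(2)` Yang–Mills on T³ — a RUNG, NOT the Clay problem); width seat `ym3-torus-px19` gen 9 (NP pen of record, ★★OWNER WORD 43).  Last of four NP files:
`CurvaturePoincareAxialLadderSums` → `CurvaturePoincareBoxBonds` → `CurvaturePoincareBoxLineSums` → THIS.

THE STATEMENT (`boxUhlenbeck` = planNP's `stub_boxUhlenbeck` with `C = 3`).  For every member `F.P K` (`d = 3`), every box of side `n` at `x₀` (`1 ≤ n`,
`2n ≤ sitesPerDir 0`) and EVERY `SU(2)` configuration `U` there is a gauge transformation `g` with
`Σ_{b : both ends in the ZMod box} dist₁((U^g)_b)² ≤ (3n)²·Σ_{p ∈ boxPlaqs} dist₁(U(∂p))²` — no small-field hypothesis, power `n¹` = the box Poincaré constant.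

THE PROOF («averaged axial gauges»).  For each of the `n` roots `y_r = lo + r·e₀` on the bottom edge of the integer box `lo + [0, n−1]³` take the axial gauge rooted at
`y_r` (`CurvaturePoincareBoxBonds.exists_rooted_gauge`).  Direction-`2` bonds, squared and summed (`CurvaturePoincareBoxLineSums.sum_sq_dir_two_le`): the `(1,2)`-line of the spine plane
`x₀ = lo₀ + r` is seen by all `n²` bonds above it, each `(0,2)`-line by `n`; with `sum_sq_dir_one_le` and the trivial direction `0` this gives, for ONE root,
`D_r ≤ n(n−1)S₀₁ + 2(n−1)(n²S₁₂(r) + nS₀₂)` (§1).  The coordinate-line sums inject into the box plaquette sum — `S₀₁, Σ_r S₁₂(r), S₀₂ ≤ Σ_{boxPlaqs} dist₁(U(∂p))²`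
(previous file) — so SUMMING OVER THE `n` ROOTS,
`Σ_r D_r ≤ 5n²(n−1)·Σ_p ≤ n·(3n)²·Σ_p`, and some root has `D_r ≤ (3n)²·Σ_p` (`Finset.exists_le_of_sum_le`) (§2).  One fixed root would only give `n³`.

HONEST SCOPE.  Deterministic lattice geometry; proves planNP's `stub_boxUhlenbeck` text (as `boxUhlenbeck`) and NOTHING ELSE: NP `stub_curvaturePinning` follows by
px16 g11's door `CurvaturePoincareGaugeTransfer.pinning_of_boxUhlenbeck` (separate file); nothing of LM ∕ B♯ (landed by others), MD, K1 (23532), 23083, `HistoryTailL`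
(19936), EX (19200), 20520 or rung R3; R3 = continuum `SU(2)` YM on T³ — NOT d = 4, NOT infinite volume, NOT a mass gap, NOT Clay.
THEOREMS ONLY (0 `def`, 0 `sorry`); `--supports stmt-QuantumFields-23532`.

References: M. Creutz, «Quarks, gluons and lattices» (1983) ch. 9 [folklore]; K. Uhlenbeck, CMP 83 (1982) 31–42 (the continuum statement this discretises, in the
large) [Uhlenbeck1982]; T. Bałaban, CMP 98 (1985) pp. 24–25 [Balaban1985Averaging].
-/

set_option autoImplicit false

open scoped BigOperators
open Literature.MathematicalPhysics.QuantumFieldTheory.Balaban1983to89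
open Literature.MathematicalPhysics.QuantumFieldTheory.Balaban1983to89.T3ContinuumYM3Torus
open Literature.MathematicalPhysics.QuantumFieldTheory.Balaban1983to89.T4AxialGaugeSmallField
  (boxPlaqs castSite castSite_apply pull pull_apply hol_pull_plaqWord_of_lt castSite_injOn_box)
open Literature.MathematicalPhysics.QuantumFieldTheory.Balaban1983to89.B7Prop1Explicit
  (e e_apply hol gaugeAct plaqWord axialFn)
open Summit.QuantumFields.YangMills.Theorems.CurvaturePoincareBoxBonds
  (le_ptP bond_coords exists_rooted_gauge gaugeAct_zero_eq_one sum_sq_dir_one_le)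
open Summit.QuantumFields.YangMills.Theorems.CurvaturePoincareBoxLineSums
  (sum_sq_dir_two_le lineSum01_le_boxSum lineSum12_le_boxSum lineSum02_le_boxSum)

namespace Summit.QuantumFields.YangMills.Theorems.CurvaturePoincareBoxUhlenbeck

section Member

variable (F : T3Family) (K : ℕ) {G : Type*} [GaugeGroup G]

/-! ## §1 One root: all box bonds -/

/-- **ALL BOX BONDS, ONE ROOT** (`r ≤ n − 1`): `D_r := Σ_{ZMod box bonds} dist₁((U^{g_r})_b)² ≤ n(n−1)·S₀₁ + 2(n−1)·(n²·S₁₂(r) + n·S₀₂)` (split by direction: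
`Finset.sum_fiberwise` + the per-direction rows; direction `0` contributes `0`). [folklore] -/
theorem sum_sq_le_of_root (U : GaugeField (F.P K) 0 G) {n : ℕ} (hn : 1 ≤ n) (h2n : 2 * n ≤ (F.P K).sitesPerDir 0) (x₀ : Site (F.P K) 0)
    {r : ℕ} (hr : r ≤ n - 1) (g : GaugeTransf (F.P K) 0 G)
    (hg : ∀ x, (fun k => ((x₀ k).val : ℤ)) ≤ x → x ≤ (fun k => ((x₀ k).val : ℤ) + ((n - 1 : ℕ) : ℤ)) →
      g (castSite x) = axialFn (pull U) ((fun k => ((x₀ k).val : ℤ)) + (r : ℤ) • e 0) x) :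
    open Classical in
    ∑ b ∈ Finset.univ.filter (fun b : PBond (F.P K) 0 => (∀ k, (b.src k - x₀ k).val < n) ∧ (∀ k, (b.tgt k - x₀ k).val < n)),
        dist1 (GaugeField.gaugeAct g U b) ^ 2 ≤
      (n : ℝ) * ((n - 1 : ℕ) : ℝ) * (∑ v₁ ∈ Finset.range (n - 1), ∑ v₂ ∈ Finset.range n, ∑ t ∈ Finset.range (n - 1),
          dist1 (hol (pull U) ((fun k => ((x₀ k).val : ℤ)) + (t : ℤ) • e 0 + (v₁ : ℤ) • e 1 + (v₂ : ℤ) • e 2) (plaqWord 0 1)) ^ 2) +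
        2 * ((n - 1 : ℕ) : ℝ) * ((n : ℝ) * (n : ℝ) * (∑ v₂ ∈ Finset.range (n - 1), ∑ s ∈ Finset.range (n - 1),
            dist1 (hol (pull U) ((fun k => ((x₀ k).val : ℤ)) + (r : ℤ) • e 0 + (s : ℤ) • e 1 + (v₂ : ℤ) • e 2) (plaqWord 1 2)) ^ 2) +
          (n : ℝ) * ∑ v₁ ∈ Finset.range n, ∑ v₂ ∈ Finset.range (n - 1), ∑ t ∈ Finset.range (n - 1),
            dist1 (hol (pull U) ((fun k => ((x₀ k).val : ℤ)) + (t : ℤ) • e 0 + (v₁ : ℤ) • e 1 + (v₂ : ℤ) • e 2) (plaqWord 0 2)) ^ 2) := by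
  classical
  set lo : Fin (F.P K).d → ℤ := fun k => ((x₀ k).val : ℤ) with hlo
  set N := n - 1 with hN
  set BB := Finset.univ.filter (fun b : PBond (F.P K) 0 => (∀ k, (b.src k - x₀ k).val < n) ∧ (∀ k, (b.tgt k - x₀ k).val < n))
    with hBB
  have hmem : ∀ (μ : Fin (F.P K).d), ∀ b ∈ BB.filter (fun b => b.dir = μ),
      (∀ k, (b.src k - x₀ k).val < n) ∧ (∀ k, (b.tgt k - x₀ k).val < n) ∧ b.dir = μ := by
    intro μ b hb
    obtain ⟨hb', hdir⟩ := Finset.mem_filter.1 hb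
    obtain ⟨-, hs, ht⟩ := Finset.mem_filter.1 hb'
    exact ⟨hs, ht, hdir⟩
  have h0 : ∑ b ∈ BB.filter (fun b => b.dir = 0), dist1 (GaugeField.gaugeAct g U b) ^ 2 = 0 := by
    refine Finset.sum_eq_zero fun b hb => ?_
    obtain ⟨hs, ht, hdir⟩ := hmem 0 b hb
    obtain ⟨hv, hvd, hsrc⟩ := bond_coords F K hn h2n x₀ b hs ht
    rw [hdir] at hvd
    have hb_eq : b = ⟨castSite (lo + (((b.src 0 - x₀ 0).val : ℕ) : ℤ) • e 0 + (((b.src 1 - x₀ 1).val : ℕ) : ℤ) • e 1 +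
        (((b.src 2 - x₀ 2).val : ℕ) : ℤ) • e 2), 0⟩ := by
      obtain ⟨src, dir⟩ := b
      simp only at hdir hsrc
      subst hdir
      exact congrArg (fun s => (⟨s, 0⟩ : PBond (F.P K) 0)) hsrc
    rw [hb_eq, gaugeAct_zero_eq_one F K U lo r g hg hvd (hv 1) (hv 2), GaugeGroup.dist1_one]
    norm_num
  have h1 := sum_sq_dir_one_le F K U hn h2n x₀ hr g hg (BB.filter fun b => b.dir = 1) (hmem 1)
  have h2 := sum_sq_dir_two_le F K U hn h2n x₀ hr g hg (BB.filter fun b => b.dir = 2) (hmem 2)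
  have hfib := (Finset.sum_fiberwise BB PBond.dir fun b => dist1 (GaugeField.gaugeAct g U b) ^ 2).symm
  have h3 : ∑ μ : Fin (F.P K).d, ∑ b ∈ BB.filter (fun b => b.dir = μ), dist1 (GaugeField.gaugeAct g U b) ^ 2 =
      (∑ b ∈ BB.filter (fun b => b.dir = 0), dist1 (GaugeField.gaugeAct g U b) ^ 2) +
        (∑ b ∈ BB.filter (fun b => b.dir = 1), dist1 (GaugeField.gaugeAct g U b) ^ 2) +
        ∑ b ∈ BB.filter (fun b => b.dir = 2), dist1 (GaugeField.gaugeAct g U b) ^ 2 :=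
    Fin.sum_univ_three _
  rw [hfib, h3, h0, zero_add]
  exact add_le_add h1 h2

/-! ## §2 The average over the roots -/

/-- The arithmetic of the average: `n·(nN·S₀₁) + 2N·n²·ΣS₁₂ + n·(2N·n·S₀₂) ≤ n·(3n)²·S` once `S₀₁, ΣS₁₂, S₀₂ ≤ S`, `N ≤ n`, `0 ≤ S`. [folklore] -/
theorem avg_arith {n N : ℕ} (hNn : N ≤ n) {S S01 S12 S02 : ℝ} (hS : 0 ≤ S) (h01 : S01 ≤ S) (h12 : S12 ≤ S) (h02 : S02 ≤ S) :
    (n : ℝ) * ((n : ℝ) * (N : ℝ) * S01) + 2 * (N : ℝ) * ((n : ℝ) * (n : ℝ)) * S12 + (n : ℝ) * (2 * (N : ℝ) * ((n : ℝ) * S02)) ≤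
      (n : ℝ) * ((3 * (n : ℝ)) ^ 2 * S) := by
  have hn0 : (0 : ℝ) ≤ n := Nat.cast_nonneg _
  have hN0 : (0 : ℝ) ≤ N := Nat.cast_nonneg _
  have hNle : (N : ℝ) ≤ n := by exact_mod_cast hNn
  have h1 : (n : ℝ) * ((n : ℝ) * (N : ℝ) * S01) ≤ (n : ℝ) * ((n : ℝ) * (N : ℝ) * S) := by gcongr
  have h2 : 2 * (N : ℝ) * ((n : ℝ) * (n : ℝ)) * S12 ≤ 2 * (N : ℝ) * ((n : ℝ) * (n : ℝ)) * S := by gcongr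
  have h3 : (n : ℝ) * (2 * (N : ℝ) * ((n : ℝ) * S02)) ≤ (n : ℝ) * (2 * (N : ℝ) * ((n : ℝ) * S)) := by gcongr
  have h4 : (N : ℝ) * ((n : ℝ) ^ 2 * S) ≤ (n : ℝ) * ((n : ℝ) ^ 2 * S) :=
    mul_le_mul_of_nonneg_right hNle (mul_nonneg (sq_nonneg _) hS)
  have h5 : 0 ≤ (n : ℝ) ^ 3 * S := mul_nonneg (pow_nonneg hn0 3) hS
  nlinarith [h1, h2, h3, h4, h5]

/-- **THE BOX UHLENBECK LEMMA, member form, any `[GaugeGroup G]`**: some root `r < n` has `D_r ≤ (3n)²·Σ_{p ∈ boxPlaqs} dist₁(U(∂p))²` (average over the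
`n` roots: `Σ_r D_r ≤ 5(n−1)n²·Σ_p ≤ n·(3n)²·Σ_p`, `Finset.exists_le_of_sum_le`). [folklore] -/
theorem exists_gauge_sum_sq_le (U : GaugeField (F.P K) 0 G) {n : ℕ} (hn : 1 ≤ n) (h2n : 2 * n ≤ (F.P K).sitesPerDir 0)
    (x₀ : Site (F.P K) 0) :
    open Classical in
    ∃ g : GaugeTransf (F.P K) 0 G,
      (∑ b ∈ Finset.univ.filter (fun b : PBond (F.P K) 0 => (∀ k, (b.src k - x₀ k).val < n) ∧ (∀ k, (b.tgt k - x₀ k).val < n)),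
          dist1 (GaugeField.gaugeAct g U b) ^ 2) ≤
        (3 * (n : ℝ)) ^ 2 * (∑ p ∈ Finset.univ.filter (fun p : Plaq (F.P K) 0 => p ∈ boxPlaqs (P := F.P K) (j := 0)
          (fun k => ((x₀ k).val : ℤ)) (fun k => ((x₀ k).val : ℤ) + ((n : ℤ) - 1))), dist1 (GaugeField.plaqHol U p) ^ 2) := by
  classical
  set lo : Fin (F.P K).d → ℤ := fun k => ((x₀ k).val : ℤ) with hlo
  set N := n - 1 with hN
  have hNn : ∀ κ, (fun k => ((x₀ k).val : ℤ) + ((n - 1 : ℕ) : ℤ)) κ - lo κ < (F.P K).sitesPerDir 0 := fun κ => by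
    show ((x₀ κ).val : ℤ) + ((n - 1 : ℕ) : ℤ) - lo κ < ((F.P K).sitesPerDir 0 : ℤ)
    simp only [hlo]
    omega
  have hex : ∀ r : ℕ, ∃ g : GaugeTransf (F.P K) 0 G, ∀ x, lo ≤ x → x ≤ (fun k => ((x₀ k).val : ℤ) + ((n - 1 : ℕ) : ℤ)) →
      g (castSite x) = axialFn (pull U) (lo + (r : ℤ) • e 0) x := fun r => exists_rooted_gauge F K U hNn _
  choose g hg using hex
  set SF := ∑ p ∈ Finset.univ.filter (fun p : Plaq (F.P K) 0 => p ∈ boxPlaqs (P := F.P K) (j := 0)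
    (fun k => ((x₀ k).val : ℤ)) (fun k => ((x₀ k).val : ℤ) + ((n : ℤ) - 1))), dist1 (GaugeField.plaqHol U p) ^ 2 with hSF
  set S01 := ∑ v₁ ∈ Finset.range N, ∑ v₂ ∈ Finset.range n, ∑ t ∈ Finset.range N,
    dist1 (hol (pull U) (lo + (t : ℤ) • e 0 + (v₁ : ℤ) • e 1 + (v₂ : ℤ) • e 2) (plaqWord 0 1)) ^ 2 with hS01
  set S12 : ℕ → ℝ := fun r => ∑ v₂ ∈ Finset.range N, ∑ s ∈ Finset.range N,
    dist1 (hol (pull U) (lo + (r : ℤ) • e 0 + (s : ℤ) • e 1 + (v₂ : ℤ) • e 2) (plaqWord 1 2)) ^ 2 with hS12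
  set S02 := ∑ v₁ ∈ Finset.range n, ∑ v₂ ∈ Finset.range N, ∑ t ∈ Finset.range N,
    dist1 (hol (pull U) (lo + (t : ℤ) • e 0 + (v₁ : ℤ) • e 1 + (v₂ : ℤ) • e 2) (plaqWord 0 2)) ^ 2 with hS02
  have h01 : S01 ≤ SF := lineSum01_le_boxSum F K U hn h2n x₀
  have h12 : ∑ r ∈ Finset.range n, S12 r ≤ SF := lineSum12_le_boxSum F K U hn h2n x₀
  have h02 : S02 ≤ SF := lineSum02_le_boxSum F K U hn h2n x₀
  have hSFnn : 0 ≤ SF := Finset.sum_nonneg fun _ _ => sq_nonneg _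
  have hD : ∀ r ∈ Finset.range n,
      (∑ b ∈ Finset.univ.filter (fun b : PBond (F.P K) 0 => (∀ k, (b.src k - x₀ k).val < n) ∧ (∀ k, (b.tgt k - x₀ k).val < n)),
          dist1 (GaugeField.gaugeAct (g r) U b) ^ 2) ≤
        (n : ℝ) * (N : ℝ) * S01 + 2 * (N : ℝ) * ((n : ℝ) * (n : ℝ) * S12 r + (n : ℝ) * S02) := fun r hr =>
    sum_sq_le_of_root F K U hn h2n x₀ (by rw [Finset.mem_range] at hr; omega) (g r) (hg r)
  clear_value S01 S12 S02 SF
  have hsplit : ∀ r : ℕ, (n : ℝ) * (N : ℝ) * S01 + 2 * (N : ℝ) * ((n : ℝ) * (n : ℝ) * S12 r + (n : ℝ) * S02) =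
      (n : ℝ) * (N : ℝ) * S01 + (2 * (N : ℝ) * ((n : ℝ) * (n : ℝ))) * S12 r + 2 * (N : ℝ) * ((n : ℝ) * S02) := fun r => by ring
  have hsum : (∑ r ∈ Finset.range n, ∑ b ∈ Finset.univ.filter (fun b : PBond (F.P K) 0 =>
        (∀ k, (b.src k - x₀ k).val < n) ∧ (∀ k, (b.tgt k - x₀ k).val < n)), dist1 (GaugeField.gaugeAct (g r) U b) ^ 2) ≤
      ∑ _r ∈ Finset.range n, (3 * (n : ℝ)) ^ 2 * SF := by
    calc (∑ r ∈ Finset.range n, ∑ b ∈ Finset.univ.filter (fun b : PBond (F.P K) 0 =>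
            (∀ k, (b.src k - x₀ k).val < n) ∧ (∀ k, (b.tgt k - x₀ k).val < n)), dist1 (GaugeField.gaugeAct (g r) U b) ^ 2)
        ≤ ∑ r ∈ Finset.range n, ((n : ℝ) * (N : ℝ) * S01 + 2 * (N : ℝ) * ((n : ℝ) * (n : ℝ) * S12 r + (n : ℝ) * S02)) :=
          Finset.sum_le_sum hD
      _ = (n : ℝ) * ((n : ℝ) * (N : ℝ) * S01) + 2 * (N : ℝ) * ((n : ℝ) * (n : ℝ)) * (∑ r ∈ Finset.range n, S12 r) +
            (n : ℝ) * (2 * (N : ℝ) * ((n : ℝ) * S02)) := by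
          simp only [hsplit, Finset.sum_add_distrib, Finset.sum_const, Finset.card_range, nsmul_eq_mul, ← Finset.mul_sum]
      _ ≤ (n : ℝ) * ((3 * (n : ℝ)) ^ 2 * SF) := avg_arith (Nat.sub_le n 1) hSFnn h01 h12 h02
      _ = ∑ _r ∈ Finset.range n, (3 * (n : ℝ)) ^ 2 * SF := by rw [Finset.sum_const, Finset.card_range, nsmul_eq_mul]
  obtain ⟨r, -, hle⟩ := Finset.exists_le_of_sum_le (Finset.nonempty_range_iff.2 (by omega)) hsum
  exact ⟨g r, hle⟩

end Member

/-! ## §3 The planNP text `stub_boxUhlenbeck` (`SU(2)`), constant `C = 3` -/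

open Classical in
/-- ★★★ **THE BOX UHLENBECK LEMMA** — the ideator's `stub_boxUhlenbeck` of `Cruxes/HistoryTailL/Lines/curvature_poincare_planNP.lean` (NP-core of LINE 30 on
stmt-QuantumFields-23532), token-identical statement, inhabited with `C = 3`: for every box of side `n` (`1 ≤ n`, `2n ≤ sitesPerDir 0`) and every `SU(2)`
configuration `U` there is a gauge transformation `g` with `Σ_{ZMod-box bonds} dist₁((U^g)_b)² ≤ (3n)²·Σ_{p ∈ boxPlaqs} dist₁(U(∂p))²`.  Proof:
`exists_gauge_sum_sq_le` (averaged axial gauges).  No small-field hypothesis; the power `n¹` is the box Poincaré constant. [folklore] -/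
theorem boxUhlenbeck :
    ∃ C : ℝ, 0 < C ∧ ∀ (F : T3Family) (K n : ℕ) (x₀ : Site (F.P K) 0), 1 ≤ n → 2 * n ≤ (F.P K).sitesPerDir 0 →
      ∀ U : GaugeField (F.P K) 0 (Matrix.specialUnitaryGroup (Fin 2) ℂ), ∃ g : GaugeTransf (F.P K) 0 (Matrix.specialUnitaryGroup (Fin 2) ℂ),
        (∑ b ∈ Finset.univ.filter (fun b : PBond (F.P K) 0 => (∀ k, (b.src k - x₀ k).val < n) ∧ (∀ k, (b.tgt k - x₀ k).val < n)), GaugeGroup.dist1 (GaugeField.gaugeAct g U b) ^ 2)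
          ≤ (C * (n : ℝ)) ^ 2 * (∑ p ∈ Finset.univ.filter (fun p : Plaq (F.P K) 0 => p ∈ boxPlaqs (P := F.P K) (j := 0) (fun k => ((x₀ k).val : ℤ)) (fun k => ((x₀ k).val : ℤ) + ((n : ℤ) - 1))), GaugeGroup.dist1 (GaugeField.plaqHol U p) ^ 2) :=
  ⟨3, by norm_num, fun F K _n x₀ hn h2n U => exists_gauge_sum_sq_le F K U hn h2n x₀⟩

end Summit.QuantumFields.YangMills.Theorems.CurvaturePoincareBoxUhlenbeck
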